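import Literature.NumberTheory.EllipticCurves.CongruenceVisibilityMultiplicative
import HarnessLib

/-!
# Route (3e) SELMER COMPANION, XXXI: agreement at a place where BOTH curves are split
# multiplicative with FULL `p`-torsion — kind (ii′), the Tate lines matched along `θ`
# (class X11a = N7; cell `b2b-bsdres`, unit `b2b-bsdres-x11a`, gen 31)

HONEST FRAMING (run/shared/lean/b2b/bsd-rank1-residual/, verbatim in every file): the goal of the
cell is to DELETE the COMBINATION-SHAPED residual classes of the Birch–Swinnerton-Dyer formula for
ALL analytic-rank `≤ 1` elliptic curves over `ℚ` — "full BSD formula for every rank `≤ 1` curve in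
class `C`" assembled STRICTLY from published theorems — so that the rank-`≤ 1` remainder becomes
exactly the CONSTRUCTION-SHAPED classes, which are TYPED (missing-input `Prop`s), NOT attempted.
This is not "finishing BSD". CLASS-OWNERS.md: research routes; NO CLAIM BEYOND STATED CLASSES.
THEOREMS ONLY (no definition, no named fact, no `sorry`); nothing is booked by this file; no label
moves. General (any number field `K : Type`, any prime `p`, any finite place `v`) and
cell-independent.

## What this file proves

Kind (ii) of the route (`WeierstrassCurve.h1Equiv_mem_selmerLocalKer_of_hasSplitMultiplicativeReductionAt`,
`Literature/…/CongruenceVisibilityMultiplicative.lean`): at a place `v` where `E = W` and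
`E' = W'` are BOTH split multiplicative, the local Kummer conditions agree along a
`Γ_K`-isomorphism `θ : E'[p] ≃ E[p]` PROVIDED `#E(K_v)[p] ≤ p` — the hypothesis is used exactly
once, to force `θ` to carry the Tate line `Φ'(μ_p) ⊂ E'[p]` onto the Tate line `Φ(μ_p) ⊂ E[p]`
(the alternative being that all of `E[p]` is `K_v`-rational). At a place with FULL `p`-torsion
(`#E(K_v)[p] = p²`; at `p = 3` over `ℚ`: split multiplicative `ℓ ≡ 1 (mod 3)` with `q` a cube)
`Γ_{K_v}` acts trivially on `E[p]` and BOTH cases occur: `θ` maps Tate line to Tate line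
(`ι_v(θ) = 1`) or not (`ι_v(θ) = p²`); the census of gens 26–30 charged such places `p²`.

**`h1Equiv_mem_selmerLocalKer_of_tateLines`** (kind (ii′)): let `Φ : K̄_v^* → E(K̄_v)` and
`Φ' : K̄_v^* → E'(K̄_v)` be `Γ_{K_v}`-equivariant homomorphisms such that every `K_v`-rational
point of `E'(K̄_v)` is `Φ'(u)` for some `u ∈ K_v^*`, and suppose **`θ` maps the line `Φ'(μ_p)`
into the line `Φ(μ_p)`**: for every `p`-th root of unity `ζ`, `θ(Φ'(ζ)) = a • Φ(ζ)` for some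
`a` (`hline`; the points compared in `E(K̄_v)` through the tree's torsion comparison
`torsionPointsEquiv` and `pointsMap`, exactly as in kind (ii)). Then `θ_* 𝓢_v(E') ≤ 𝓢_v(E)`.
NO hypothesis on `#E(K_v)[p]` or on reduction types; no named fact enters: steps (1) and (3)
of the kind-(ii) proof verbatim (`φ(σ) = Φ'(σw/w) + (σT − T)` locally; transport
`= Φ((σw/w)^a) + (σ θT − θT) = σb − b`, `b = Φ(w^a) + θT`), step (2) being the hypothesis.

`relIndex_map_selmerLocalKer_eq_one_of_tateLines`: the index form `ι_v(θ) = 1`.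
`h1Equiv_mem_selmerLocalKer_of_split_of_card_le_via_tateLines` — sanity anchor: kind (ii) is
RE-DERIVED from kind (ii′) (under `hU` and `#E(K_v)[p] ≤ p` the Tate data of the named fact
satisfy `hline`, by the dichotomy `exists_eq_nsmul_or_forall_smul_eq`).

## How the hypothesis is discharged per pair (INPUT OF RECORD, not a class statement)

Through the abstract-agreement shapes of files XXVII/XXVIII (`hagree` at `v` = this file's
conclusion, `K = ℚ`): `(Φ, Φ')` = the ACTUAL Tate parametrisations of `A`, `E` at `ℓ` (Silverman
*ATAEC* V.3.1 (c),(d), V.5.3 (a),(b) — named fact A40), whose line `Φ(μ_p)` is the `p`-torsion of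
`E_0(K_v) ≅ R^*` (*ATAEC* IV Rem. 9.6), i.e. the rational `p`-torsion with NON-SINGULAR reduction
on the minimal model; `hline` = the finite certificate "`θ` (unique up to a scalar, `E[p]`
absolutely irreducible on N7) maps the non-singularly reducing `p`-torsion of `E` to that of `A`",
computed EXACTLY in `ℚ(x(P))` (engine 1: PARI kit j143979, `HOME/code/b2b-bsdres-x11a/gen31/`;
REPORT-g31.md §2). EVIDENCE for a per-pair booking decided by the referee; nothing booked here.

## References

* [SilvermanATAEC1994] J. H. Silverman, *Advanced Topics in the Arithmetic of Elliptic Curves*,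
  GTM 151 (1994), Ch. IV Rem. 9.6; Ch. V Thm. 3.1 (c),(d), Thm. 5.3 (a),(b).
* [MazurRubin2004] B. Mazur, K. Rubin, *Kolyvagin systems*, Mem. AMS 799 (2004), §2.3.
* [CremonaMazur2000] J. E. Cremona, B. Mazur, Experiment. Math. 9 (2000), §3.
* Tree: `CongruenceVisibilityMultiplicative.lean` (kind (ii)); HOME/b2b-bsdres-x11a/REPORT-g31.md.
-/

set_option autoImplicit false

noncomputable section

open scoped Classical

open WeierstrassCurve Literature.NumberTheory.EllipticCurves
  Literature.NumberTheory.GaloisRepresentations Field NumberField IsDedekindDomain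

namespace Summit.BirchSwinnertonDyer.Rank1Residual.X11a.SelmerCompanion

section Local

variable {K : Type} [Field K] [NumberField K] (W W' : WeierstrassCurve K)
  {p : ℕ} [hp : Fact p.Prime] (v : HeightOneSpectrum (𝓞 K))

/-- **Kind (ii′): the local Kummer conditions of two `p`-congruent curves agree at a place where
`θ` matches the Tate lines.** Let `E = W`, `E' = W'` be elliptic curves over a number field `K`,
`θ : E'[p] ≃ E[p]` a `Γ_K`-isomorphism, `v` a finite place, and `Φ : K̄_v^* → E(K̄_v)`,
`Φ' : K̄_v^* → E'(K̄_v)` additive `Γ_{K_v}`-equivariant maps (`hequiv`, `hequiv'`) such that every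
`K_v`-rational point of `E'(K̄_v)` is `Φ'(u)` with `u ∈ K_v^*` (`hrat'`) — e.g. the Tate
parametrisations of Silverman *ATAEC* V.3.1/V.5.3 at a place where both curves are split
multiplicative. If `θ` maps the line `Φ'(μ_p)` into the line `Φ(μ_p)` (`hline`: for every `p`-th
root of unity `ζ`, the transport of `Φ'(ζ)` is a multiple of `Φ(ζ)`), then every class of
`H¹(K, E'[p])` satisfying the local Selmer condition of `E'` at `v` transports under `θ_*` to a
class satisfying the local Selmer condition of `E` at `v` (`θ_* 𝓢_v(E') ≤ 𝓢_v(E)`). No hypothesis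
on `#E(K_v)[p]`: this is kind (ii) of `CongruenceVisibilityMultiplicative.lean` with its single use
of `#E(K_v)[p] ≤ p` — forcing the lines to match — replaced by the matching itself, which at a place
with full `p`-torsion is a genuine condition (a finite certificate per pair, module docstring).
[cite: SilvermanATAEC1994, Ch. V Thm. 3.1 (c),(d), Thm. 5.3; Ch. IV Rem. 9.6]
[cite: MazurRubin2004, §2.3] -/
theorem h1Equiv_mem_selmerLocalKer_of_tateLines [W'.IsElliptic] (hn : (p : ℤ) ≠ 0)
    (θ : geomTorsion W' (p : ℤ) ≃+ geomTorsion W (p : ℤ))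
    (hθ : ∀ (σ : absoluteGaloisGroup K) (P : geomTorsion W' (p : ℤ)), θ (σ • P) = σ • θ P)
    (Φ : Additive (AlgebraicClosure (v.adicCompletion K))ˣ →+ localPoints W (v.adicCompletion K))
    (Φ' : Additive (AlgebraicClosure (v.adicCompletion K))ˣ →+ localPoints W' (v.adicCompletion K))
    (hequiv : ∀ (σ : absoluteGaloisGroup (v.adicCompletion K))
        (u : (AlgebraicClosure (v.adicCompletion K))ˣ),
      σ • Φ (Additive.ofMul u) = Φ (Additive.ofMul (Units.map
        (absoluteGaloisGroup.toAlgEquiv _ σ : AlgebraicClosure (v.adicCompletion K) →*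
          AlgebraicClosure (v.adicCompletion K)) u)))
    (hequiv' : ∀ (σ : absoluteGaloisGroup (v.adicCompletion K))
        (u : (AlgebraicClosure (v.adicCompletion K))ˣ),
      σ • Φ' (Additive.ofMul u) = Φ' (Additive.ofMul (Units.map
        (absoluteGaloisGroup.toAlgEquiv _ σ : AlgebraicClosure (v.adicCompletion K) →*
          AlgebraicClosure (v.adicCompletion K)) u)))
    (hrat' : ∀ P : localPoints W' (v.adicCompletion K),
      (∀ σ : absoluteGaloisGroup (v.adicCompletion K), σ • P = P) →
      ∃ u : (v.adicCompletion K)ˣ, Φ' (Additive.ofMul (Units.map (algebraMap (v.adicCompletion K)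
        (AlgebraicClosure (v.adicCompletion K)) : v.adicCompletion K →*
          AlgebraicClosure (v.adicCompletion K)) u)) = P)
    (hline : ∀ (ζ : (AlgebraicClosure (v.adicCompletion K))ˣ), ζ ^ p = 1 →
      ∀ hζ : Φ' (Additive.ofMul ζ) ∈
          AddSubgroup.torsionBy (localPoints W' (v.adicCompletion K)) (p : ℤ),
      ∃ a : ℕ, pointsMap W (v.adicCompletion K)
          ((θ ((W'.torsionPointsEquiv (p : ℤ) (E := v.adicCompletion K) hn).symm
            ⟨Φ' (Additive.ofMul ζ), hζ⟩) : geomTorsion W (p : ℤ)) : geomPoints W) =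
        a • Φ (Additive.ofMul ζ))
    {c : galH1Torsion W' (p : ℤ)} (hc : c ∈ selmerLocalKer W' (v.adicCompletion K) (p : ℤ)) :
    h1Equiv θ hθ c ∈ selmerLocalKer W (v.adicCompletion K) (p : ℤ) := by
  have hpp : p.Prime := hp.out
  haveI : NeZero p := ⟨hpp.ne_zero⟩
  haveI : CharZero (v.adicCompletion K) := charZero_adicCompletion v
  haveI : CharZero (AlgebraicClosure (v.adicCompletion K)) := charZero_of_injective_algebraMap
      (algebraMap (v.adicCompletion K) (AlgebraicClosure (v.adicCompletion K))).injective
  -- a primitive `p`-th root of unity `ζ₀ = Z`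
  obtain ⟨ζ₀, hζ₀⟩ := HasEnoughRootsOfUnity.exists_primitiveRoot (AlgebraicClosure
      (v.adicCompletion K)) p
  have hZu : IsUnit ζ₀ := hζ₀.isUnit hpp.ne_zero
  set Z : (AlgebraicClosure (v.adicCompletion K))ˣ := hZu.unit with hZdef
  have hZ : IsPrimitiveRoot (Z : (AlgebraicClosure (v.adicCompletion K))) p := by
    rw [hZdef, IsUnit.unit_spec]; exact hζ₀
  have hZp : Z ^ p = 1 :=
    Units.ext (by rw [Units.val_pow_eq_pow_val, hZ.pow_eq_one, Units.val_one])
  -- the torsion comparison `E'[p](K̄) ≃ E'(K̄_v)[p]` and the transport `G = pointsMap ∘ θ ∘ e'⁻¹`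
  set e' := W'.torsionPointsEquiv (p : ℤ) (E := (v.adicCompletion K)) hn with he'
  set G : AddSubgroup.torsionBy (localPoints W' (v.adicCompletion K)) (p : ℤ) →+ localPoints W
      (v.adicCompletion K) :=
    ((pointsMap W (v.adicCompletion K)).comp (geomTorsion W (p : ℤ)).subtype).comp
      (θ.toAddMonoidHom.comp e'.symm.toAddMonoidHom) with hG
  have hG_apply : ∀ T, G T = pointsMap W (v.adicCompletion K) ((θ (e'.symm T) : geomTorsion W
      (p : ℤ)) : geomPoints W) := fun T ↦ rfl
  -- `Φ'(μ_p) ⊆ E'(K̄_v)[p]`; the point `XZ = Φ'(ζ₀)` and the line matching `G XZ = a • Φ(ζ₀)`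
  have hmem' : ∀ {ζ : (AlgebraicClosure (v.adicCompletion K))ˣ}, ζ ^ p = 1 →
      Φ' (Additive.ofMul ζ) ∈ AddSubgroup.torsionBy (localPoints W' (v.adicCompletion K)) (p : ℤ) :=
    fun hζ ↦ (Submodule.mem_torsionBy_iff _ _).mpr
        (W'.zsmul_map_ofMul_eq_zero_of_pow_eq_one v Φ' hζ)
  set XZ : AddSubgroup.torsionBy (localPoints W' (v.adicCompletion K)) (p : ℤ) := ⟨Φ'
      (Additive.ofMul Z), hmem' hZp⟩ with hXZ
  obtain ⟨a, ha⟩ : ∃ a : ℕ, G XZ = a • Φ (Additive.ofMul Z) := by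
    obtain ⟨a, ha⟩ := hline Z hZp (hmem' hZp)
    exact ⟨a, by rw [hG_apply]; exact ha⟩
  have hclaim : ∀ (ζ : (AlgebraicClosure (v.adicCompletion K))ˣ) (hζ : ζ ^ p = 1),
      G ⟨Φ' (Additive.ofMul ζ), hmem' hζ⟩ = Φ (Additive.ofMul (ζ ^ a)) := by
    intro ζ hζ
    obtain ⟨k, -, hk⟩ := hZ.eq_pow_of_pow_eq_one (ξ := (ζ : (AlgebraicClosure
        (v.adicCompletion K))))
      (by rw [← Units.val_pow_eq_pow_val, hζ, Units.val_one])
    have hζk : ζ = Z ^ k := Units.ext (by rw [← hk, Units.val_pow_eq_pow_val])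
    have hX : (⟨Φ' (Additive.ofMul ζ), hmem' hζ⟩ : AddSubgroup.torsionBy (localPoints W'
        (v.adicCompletion K)) (p : ℤ)) =
        k • XZ := Subtype.ext (by
      rw [AddSubgroupClass.coe_nsmul, hXZ]
      change Φ' (Additive.ofMul ζ) = k • Φ' (Additive.ofMul Z)
      rw [hζk, ofMul_pow, map_nsmul])
    rw [hX, map_nsmul, ha, hζk, ← pow_mul, ofMul_pow, map_nsmul, mul_nsmul']
  -- the class `c` and a point `a'` trivialising it locally for `E'`
  obtain ⟨φ, rfl⟩ :=
    oneCocycleClass_surjective (discreteTopRep (absoluteGaloisGroup K) (geomTorsion W' (p : ℤ))) c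
  rw [selmerLocalKer, oneCocycleClass_mem_resKer_iff] at hc
  obtain ⟨a', ha'⟩ := hc
  have ha'' : ∀ σ : (absoluteGaloisGroup (v.adicCompletion K)), pointsMap W' (v.adicCompletion K)
      ((φ.1 (resGal (K := K) (v.adicCompletion K) σ) : geomTorsion W' (p : ℤ)) :
      geomPoints W') = σ • a' - a' := fun σ ↦ ha' σ
  -- `P' = p • a'` is `K_v`-rational, hence `= Φ'(u)` with `u ∈ K_v^*`
  have hP'fix : ∀ σ : (absoluteGaloisGroup (v.adicCompletion K)), σ • ((p : ℤ) • a') =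
      (p : ℤ) • a' := by
    intro σ
    have h0 : (p : ℤ) • (σ • a' - a') = 0 := by
      rw [← ha'' σ, ← map_zsmul, (mem_geomTorsion_iff W' _ _).mp (φ.1 _).2, map_zero]
    rw [W'.smul_zsmul_localPoints (p : ℤ) σ a']
    rw [zsmul_sub, sub_eq_zero] at h0
    exact h0
  obtain ⟨u, hu⟩ := hrat' ((p : ℤ) • a') hP'fix
  -- a `p`-th root `w` of `u`, the point `R' = Φ'(w)` with `p R' = P'`, and `T = a' - R' ∈ E'[p]`
  set uu : (AlgebraicClosure (v.adicCompletion K))ˣ := Units.map (algebraMap (v.adicCompletion K)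
      (AlgebraicClosure (v.adicCompletion K)) : (v.adicCompletion K) →* (AlgebraicClosure
      (v.adicCompletion K))) u with huu
  have huu0 : (uu : (AlgebraicClosure (v.adicCompletion K))) ≠ 0 := uu.ne_zero
  obtain ⟨z, hz⟩ := IsAlgClosed.exists_pow_nat_eq (uu : (AlgebraicClosure
      (v.adicCompletion K))) hpp.pos
  have hz0 : z ≠ 0 := by
    rintro rfl
    rw [zero_pow hpp.ne_zero] at hz
    exact huu0 hz.symm
  set w : (AlgebraicClosure (v.adicCompletion K))ˣ := Units.mk0 z hz0 with hw
  have hwp : w ^ p = uu := Units.ext (by rw [Units.val_pow_eq_pow_val, hw, Units.val_mk0, hz])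
  set R' : localPoints W' (v.adicCompletion K) := Φ' (Additive.ofMul w) with hR'
  have hR'p : (p : ℤ) • R' = (p : ℤ) • a' := by
    rw [hR', ← map_zsmul, ← ofMul_zpow, zpow_natCast, hwp, huu, hu]
  set T : localPoints W' (v.adicCompletion K) := a' - R' with hT
  have hTp : (p : ℤ) • T = 0 := by rw [hT, zsmul_sub, hR'p, sub_self]
  set Tt : AddSubgroup.torsionBy (localPoints W' (v.adicCompletion K)) (p : ℤ) :=
    ⟨T, (Submodule.mem_torsionBy_iff _ _).mpr hTp⟩ with hTt
  set T₀ : geomTorsion W' (p : ℤ) := e'.symm Tt with hT₀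
  have hT₀ : pointsMap W' (v.adicCompletion K) (T₀ : geomPoints W') = T := by
    rw [hT₀, he', W'.pointsMap_torsionPointsEquiv_symm (p : ℤ) hn Tt]
  -- `ζ_σ = σw / w` is a `p`-th root of unity (`σ` fixes `u ∈ K_v`)
  have hσuu : ∀ σ : (absoluteGaloisGroup (v.adicCompletion K)),
      (absoluteGaloisGroup.toAlgEquiv _ σ : AlgebraicClosure (v.adicCompletion K) →*
        AlgebraicClosure (v.adicCompletion K)) (uu : (AlgebraicClosure (v.adicCompletion K))) = uu := by
    intro σ
    rw [huu, Units.coe_map, MonoidHom.coe_coe, MonoidHom.coe_coe, AlgEquiv.commutes]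
  have hζσ : ∀ σ : (absoluteGaloisGroup (v.adicCompletion K)), (Units.map
      (absoluteGaloisGroup.toAlgEquiv _ σ : AlgebraicClosure (v.adicCompletion K)
      →* AlgebraicClosure (v.adicCompletion K)) w / w) ^ p = 1 := by
    intro σ
    apply Units.ext
    rw [Units.val_pow_eq_pow_val, Units.val_div_eq_div_val, div_pow, Units.coe_map, ← map_pow,
      ← Units.val_pow_eq_pow_val, hwp, hσuu, div_self huu0, Units.val_one]
  -- the cocycle of `E'`: `φ(σ) = e'⁻¹ Φ'(ζ_σ) + (σ T₀ - T₀)`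
  have hφσ : ∀ σ : (absoluteGaloisGroup (v.adicCompletion K)), φ.1 (resGal (K := K)
      (v.adicCompletion K) σ) =
      e'.symm ⟨Φ' (Additive.ofMul (Units.map
          (absoluteGaloisGroup.toAlgEquiv _ σ : AlgebraicClosure (v.adicCompletion K)
          →* AlgebraicClosure (v.adicCompletion K)) w / w)), hmem' (hζσ σ)⟩ +
        (resGal (K := K) (v.adicCompletion K) σ • T₀ - T₀) := by
    intro σ
    apply Subtype.ext
    apply pointsMapOfEmb_injective W' (closureEmb (K := K) (v.adicCompletion K))
    change pointsMap W' (v.adicCompletion K) _ = pointsMap W' (v.adicCompletion K) _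
    rw [ha'' σ, AddSubgroup.coe_add, AddSubgroup.coe_sub, map_add, map_sub,
      Literature.NumberTheory.EllipticCurves.AddSubgroup.torsionBy.coe_smul, pointsMap_smul, hT₀,
      he', W'.pointsMap_torsionPointsEquiv_symm (p : ℤ) hn]
    change σ • a' - a' = Φ' (Additive.ofMul (Units.map
        (absoluteGaloisGroup.toAlgEquiv _ σ : AlgebraicClosure (v.adicCompletion K)
        →* AlgebraicClosure (v.adicCompletion K)) w / w)) + (σ • T - T)
    rw [ofMul_div, map_sub, ← hequiv' σ w, ← hR', hT, smul_sub]
    abel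
  -- the witness for `E`: `b = Φ(w^a) + θ T₀`
  rw [h1Equiv_oneCocycleClass, selmerLocalKer, oneCocycleClass_mem_resKer_iff]
  refine ⟨Φ (Additive.ofMul (w ^ a)) +
    pointsMap W (v.adicCompletion K) ((θ T₀ : geomTorsion W (p : ℤ)) : geomPoints W), fun σ ↦ ?_⟩
  change pointsMap W (v.adicCompletion K) ((θ (φ.1 (resGal (K := K)
      (v.adicCompletion K) σ)) : geomTorsion W (p : ℤ)) :
    geomPoints W) = _
  have hmp : Units.map (absoluteGaloisGroup.toAlgEquiv _ σ : AlgebraicClosure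
      (v.adicCompletion K) →* AlgebraicClosure (v.adicCompletion K)) (w ^ a) = (Units.map
      (absoluteGaloisGroup.toAlgEquiv _ σ : AlgebraicClosure (v.adicCompletion K) →*
        AlgebraicClosure (v.adicCompletion K)) w) ^ a :=
    map_pow _ w a
  have hdp : (Units.map (absoluteGaloisGroup.toAlgEquiv _ σ : AlgebraicClosure
      (v.adicCompletion K) →* AlgebraicClosure (v.adicCompletion K)) w / w) ^ a = (Units.map
      (absoluteGaloisGroup.toAlgEquiv _ σ : AlgebraicClosure (v.adicCompletion K)
      →* AlgebraicClosure (v.adicCompletion K)) w) ^ a / w ^ a := div_pow _ _ a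
  rw [hφσ σ, map_add, map_sub, AddSubgroup.coe_add, AddSubgroup.coe_sub, map_add, map_sub,
    ← hG_apply, hclaim _ (hζσ σ), hθ,
    Literature.NumberTheory.EllipticCurves.AddSubgroup.torsionBy.coe_smul, pointsMap_smul,
    smul_add, hequiv σ (w ^ a), hmp, hdp, ofMul_div, map_sub]
  abel

/-- **`ι_v(θ) = 1` at a place where `θ` matches the Tate lines** — the comparison index of
`CongruenceVisibilityComparison.lean` (`[θ_* 𝓢_v(E') : θ_* 𝓢_v(E') ∩ 𝓢_v(E)]`) is `1` under the
hypotheses of `h1Equiv_mem_selmerLocalKer_of_tateLines`; the form the counts of files I/XIII use.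
[cite: SilvermanATAEC1994, Ch. V Thm. 3.1 (c),(d), Thm. 5.3] [cite: MazurRubin2004, §2.3] -/
theorem relIndex_map_selmerLocalKer_eq_one_of_tateLines [W'.IsElliptic] (hn : (p : ℤ) ≠ 0)
    (θ : geomTorsion W' (p : ℤ) ≃+ geomTorsion W (p : ℤ))
    (hθ : ∀ (σ : absoluteGaloisGroup K) (P : geomTorsion W' (p : ℤ)), θ (σ • P) = σ • θ P)
    (Φ : Additive (AlgebraicClosure (v.adicCompletion K))ˣ →+ localPoints W (v.adicCompletion K))
    (Φ' : Additive (AlgebraicClosure (v.adicCompletion K))ˣ →+ localPoints W' (v.adicCompletion K))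
    (hequiv : ∀ (σ : absoluteGaloisGroup (v.adicCompletion K))
        (u : (AlgebraicClosure (v.adicCompletion K))ˣ),
      σ • Φ (Additive.ofMul u) = Φ (Additive.ofMul (Units.map
        (absoluteGaloisGroup.toAlgEquiv _ σ : AlgebraicClosure (v.adicCompletion K) →*
          AlgebraicClosure (v.adicCompletion K)) u)))
    (hequiv' : ∀ (σ : absoluteGaloisGroup (v.adicCompletion K))
        (u : (AlgebraicClosure (v.adicCompletion K))ˣ),
      σ • Φ' (Additive.ofMul u) = Φ' (Additive.ofMul (Units.map
        (absoluteGaloisGroup.toAlgEquiv _ σ : AlgebraicClosure (v.adicCompletion K) →*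
          AlgebraicClosure (v.adicCompletion K)) u)))
    (hrat' : ∀ P : localPoints W' (v.adicCompletion K),
      (∀ σ : absoluteGaloisGroup (v.adicCompletion K), σ • P = P) →
      ∃ u : (v.adicCompletion K)ˣ, Φ' (Additive.ofMul (Units.map (algebraMap (v.adicCompletion K)
        (AlgebraicClosure (v.adicCompletion K)) : v.adicCompletion K →*
          AlgebraicClosure (v.adicCompletion K)) u)) = P)
    (hline : ∀ (ζ : (AlgebraicClosure (v.adicCompletion K))ˣ), ζ ^ p = 1 →
      ∀ hζ : Φ' (Additive.ofMul ζ) ∈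
          AddSubgroup.torsionBy (localPoints W' (v.adicCompletion K)) (p : ℤ),
      ∃ a : ℕ, pointsMap W (v.adicCompletion K)
          ((θ ((W'.torsionPointsEquiv (p : ℤ) (E := v.adicCompletion K) hn).symm
            ⟨Φ' (Additive.ofMul ζ), hζ⟩) : geomTorsion W (p : ℤ)) : geomPoints W) =
        a • Φ (Additive.ofMul ζ)) :
    (selmerLocalKer W (v.adicCompletion K) (p : ℤ)).relIndex
        ((selmerLocalKer W' (v.adicCompletion K) (p : ℤ)).map (h1Equiv θ hθ).toAddMonoidHom) = 1 :=
  (relIndex_map_selmerLocalKer_eq_one_iff W W' θ hθ).mpr fun _ hc ↦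
    h1Equiv_mem_selmerLocalKer_of_tateLines W W' v hn θ hθ Φ Φ' hequiv hequiv' hrat' hline hc

/-- **Kind (ii) re-derived from kind (ii′) (sanity anchor).** Granted Tate's uniformisation
(`hU`), at a finite place `v` where `E` and `E'` are both split multiplicative with
`#E(K_v)[p] ≤ p`, the Tate data of the named fact satisfy the line-matching hypothesis of
`h1Equiv_mem_selmerLocalKer_of_tateLines` — the dichotomy `exists_eq_nsmul_or_forall_smul_eq`:
either `θ` carries `Φ'(ζ₀)` to a multiple of `Φ(ζ₀)`, or all of `E[p]` is `K_v`-rational, which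
`#E(K_v)[p] ≤ p` forbids — so `θ_* 𝓢_v(E') ≤ 𝓢_v(E)`; this is
`WeierstrassCurve.h1Equiv_mem_selmerLocalKer_of_hasSplitMultiplicativeReductionAt` again, now as
the special case "lines forced to match" of kind (ii′).
[cite: SilvermanATAEC1994, Ch. V Thm. 3.1 (c),(d), Thm. 5.3] [cite: CremonaMazur2000, §3] -/
theorem h1Equiv_mem_selmerLocalKer_of_split_of_card_le_via_tateLines [W.IsElliptic] [W'.IsElliptic]
    (hU : Silverman1994_thmV53_tateUniformisation.{0})
    (θ : geomTorsion W' (p : ℤ) ≃+ geomTorsion W (p : ℤ))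
    (hθ : ∀ (σ : absoluteGaloisGroup K) (P : geomTorsion W' (p : ℤ)), θ (σ • P) = σ • θ P)
    (hW : W.HasSplitMultiplicativeReductionAt v) (hW' : W'.HasSplitMultiplicativeReductionAt v)
    (hcard : Nat.card (nsmulAddMonoidHom p : (W.baseChange (v.adicCompletion K)).toAffine.Point
        →+ _).ker ≤ p)
    {c : galH1Torsion W' (p : ℤ)} (hc : c ∈ selmerLocalKer W' (v.adicCompletion K) (p : ℤ)) :
    h1Equiv θ hθ c ∈ selmerLocalKer W (v.adicCompletion K) (p : ℤ) := by
  have hpp : p.Prime := hp.out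
  haveI : NeZero p := ⟨hpp.ne_zero⟩
  have hn : (p : ℤ) ≠ 0 := by exact_mod_cast hpp.ne_zero
  -- Tate parametrisations of `E` and `E'` at `v`
  obtain ⟨q, Φ, hq0, hq1, -, hker, hequiv₀, -⟩ := hU W v hW
  obtain ⟨q', Φ', -, -, -, -, hequiv₀', hrat'⟩ := hU W' v hW'
  refine h1Equiv_mem_selmerLocalKer_of_tateLines W W' v hn θ hθ Φ Φ' (fun σ u ↦ hequiv₀ σ u)
    (fun σ u ↦ hequiv₀' σ u) hrat' (fun ζ hζ hζmem ↦ ?_) hc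
  -- the line matching for `ζ`: trivial for `ζ = 1`, the dichotomy for a primitive root
  by_cases hζ1 : ζ = 1
  · refine ⟨0, ?_⟩
    have h0 : (⟨Φ' (Additive.ofMul ζ), hζmem⟩ : AddSubgroup.torsionBy (localPoints W'
        (v.adicCompletion K)) (p : ℤ)) = 0 := Subtype.ext (by
      change Φ' (Additive.ofMul ζ) = 0
      rw [hζ1, ofMul_one, map_zero])
    rw [h0, map_zero, map_zero, ZeroMemClass.coe_zero, map_zero, zero_nsmul]
  have hZ : IsPrimitiveRoot (ζ : AlgebraicClosure (v.adicCompletion K)) p := by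
    have hζ' : (ζ : AlgebraicClosure (v.adicCompletion K)) ^ p = 1 := by
      rw [← Units.val_pow_eq_pow_val, hζ, Units.val_one]
    have hζ1' : (ζ : AlgebraicClosure (v.adicCompletion K)) ≠ 1 := fun h ↦ hζ1 (Units.ext h)
    have ho := orderOf_eq_prime hζ' hζ1'
    rw [← ho]
    exact IsPrimitiveRoot.orderOf _
  -- the transport `G = pointsMap ∘ θ ∘ e'⁻¹` and the point `L₂ = G(Φ'(ζ))`
  set e' := W'.torsionPointsEquiv (p : ℤ) (E := (v.adicCompletion K)) hn with he'
  set G : AddSubgroup.torsionBy (localPoints W' (v.adicCompletion K)) (p : ℤ) →+ localPoints W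
      (v.adicCompletion K) :=
    ((pointsMap W (v.adicCompletion K)).comp (geomTorsion W (p : ℤ)).subtype).comp
      (θ.toAddMonoidHom.comp e'.symm.toAddMonoidHom) with hG
  have hG_apply : ∀ T, G T = pointsMap W (v.adicCompletion K) ((θ (e'.symm T) : geomTorsion W
      (p : ℤ)) : geomPoints W) := fun T ↦ rfl
  have hGsmul : ∀ (σ : (absoluteGaloisGroup (v.adicCompletion K))) (T : AddSubgroup.torsionBy
      (localPoints W' (v.adicCompletion K)) (p : ℤ)),
      G (σ • T) = σ • G T := by
    intro σ T
    rw [hG_apply, hG_apply, he', torsionPointsEquiv_symm_smul, hθ,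
      Literature.NumberTheory.EllipticCurves.AddSubgroup.torsionBy.coe_smul, pointsMap_smul]
  set XZ : AddSubgroup.torsionBy (localPoints W' (v.adicCompletion K)) (p : ℤ) :=
    ⟨Φ' (Additive.ofMul ζ), hζmem⟩ with hXZ
  have hL₂p : (p : ℤ) • G XZ = 0 := by
    have h0 : (p : ℤ) • XZ = 0 := Subtype.ext (by
      rw [AddSubgroupClass.coe_zsmul, hXZ, AddSubgroup.coe_zero]
      exact W'.zsmul_map_ofMul_eq_zero_of_pow_eq_one v Φ' hζ)
    rw [← map_zsmul, h0, map_zero]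
  have hL₂σ : ∀ (σ : (absoluteGaloisGroup (v.adicCompletion K))) (c : ℕ), Units.map
      (absoluteGaloisGroup.toAlgEquiv _ σ : AlgebraicClosure (v.adicCompletion K) →*
        AlgebraicClosure (v.adicCompletion K)) ζ = ζ ^ c → σ • G XZ = c • G XZ := by
    intro σ c hc
    have h1 : σ • XZ = c • XZ := Subtype.ext (by
      rw [Literature.NumberTheory.EllipticCurves.AddSubgroup.torsionBy.coe_smul,
        AddSubgroupClass.coe_nsmul, hXZ]
      change σ • Φ' (Additive.ofMul ζ) = c • Φ' (Additive.ofMul ζ)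
      rw [hequiv₀', hc, ofMul_pow, map_nsmul])
    rw [← hGsmul, h1, map_nsmul]
  -- the dichotomy: lines matched, or all of `E[p]` is `K_v`-rational (excluded by `hcard`)
  rcases W.exists_eq_nsmul_or_forall_smul_eq v hq0 hq1 Φ hker (fun σ u ↦ hequiv₀ σ u) hZ hL₂p
    hL₂σ with
    ⟨a, ha⟩ | hfix
  · exact ⟨a, by rw [← hG_apply]; exact ha⟩
  · exfalso
    have h1 := W.sq_le_card_ker_nsmul_of_forall_smul_eq v hfix
    have h2 : p < p ^ 2 := by
      have := hpp.two_le
      nlinarith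
    omega

end Local

end Summit.BirchSwinnertonDyer.Rank1Residual.X11a.SelmerCompanion

end
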